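import Summits.AnomalousDissipation.AnomalousDissipation.Theorems.SawtoothPulseCascadeK1LocalisedCascadeSymbolCone
import Summits.AnomalousDissipation.AnomalousDissipation.Theorems.SawtoothPulseCascadeK1LocalisedCascadeSymbolFibreTools

/-!
# K1loc, line `Spectral` / SeqCone — helper: PRODUCT SYMBOLS (cone × envelope) ON THE LATTICE AND ALONG FIBRES (S-B symbol data)

Helper file of the prover lane on the crux `K1LocalisedCascade` (stmt-AnomalousDissipation-19491), route
`SawtoothPulseCascade` (glue seat k1loc-p3; for `…FibreSocket.fibre_estimate_of_profile_data`, which wants the tracked symbol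
`≡ 1` on the fibres beyond an envelope radius).  The tracked symbol of the assembly is `μ̂ = 1 − g·g_env`, the product of a
cone–radial good-region indicator `g ∈ {g^S, g^M}` and the envelope indicator `g_env` of `…SymbolLattice` (both `[0,1]`-valued).
Lattice side (any `g₁, g₂ : ℤ → ℤ → ℝ` with values in `[0,1]`): `prod_nonneg/le_one`, `prod_ne_zero`, `one_sub_prod_eq_one_of_right_eq_zero`
(the `hone` of the socket: `g_env = 0` beyond its radius), the IMPLICATION forms of the cone/envelope steps
`eq_one_of_ne_zero_H/V/env` (the inner step of `compat_H/compat_V/compat_env`), and `compat_mul` — compatibility of the product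
from the two implications.  Fibre side (generic, for `…LeibnizScale`): `abs_iteratedDeriv_one_sub_le_of_scale` (`1 − μ`),
`abs_iteratedDeriv_one_sub_mul_le_of_scale` (`1 − f·g`), `abs_iteratedDeriv_one_sub_mul_sq_le_of_scale` (`(1 − f·g)²`):
all-orders `C/bⁿ` bounds from those of the factors, so the Taylor data of `μ̂`, `ν̂` follow from `…SymbolFibreDataH/V` and the
envelope profiles.  No definitions; no statement about the stub.
[cite: ElgindiLissMattingly2025, §1.2.2 (cones and cocycle)] [cite: Grafakos2014, Prop. 3.1.2 (5)] [problem: turb]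
-/

-- `Summit.<Summit>.<Problem>`: single-conjunct summit, the duplicate namespace segment is deliberate.
set_option linter.dupNamespace false

noncomputable section

namespace Summit.AnomalousDissipation.AnomalousDissipation.Theorems.SawtoothPulseCascade.K1Symbol

open Set
open scoped ContDiff

/-! ## Products of good-region indicators on the lattice -/

/-- `0 ≤ g₁g₂`. [folklore] -/
theorem prod_nonneg {g₁ g₂ : ℤ → ℤ → ℝ} (h₁ : ∀ kh kv, 0 ≤ g₁ kh kv) (h₂ : ∀ kh kv, 0 ≤ g₂ kh kv) (kh kv : ℤ) :
    0 ≤ g₁ kh kv * g₂ kh kv := mul_nonneg (h₁ kh kv) (h₂ kh kv)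

/-- `g₁g₂ ≤ 1`. [folklore] -/
theorem prod_le_one {g₁ g₂ : ℤ → ℤ → ℝ} (h₁ : ∀ kh kv, g₁ kh kv ≤ 1) (h₂0 : ∀ kh kv, 0 ≤ g₂ kh kv)
    (h₂ : ∀ kh kv, g₂ kh kv ≤ 1) (kh kv : ℤ) : g₁ kh kv * g₂ kh kv ≤ 1 :=
  mul_le_one₀ (h₁ kh kv) (h₂0 kh kv) (h₂ kh kv)

/-- Support of the product: `g₁g₂ ≠ 0 ⇒ g₁ ≠ 0 ∧ g₂ ≠ 0`. [folklore] -/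
theorem prod_ne_zero {g₁ g₂ : ℤ → ℤ → ℝ} {kh kv : ℤ} (h : g₁ kh kv * g₂ kh kv ≠ 0) : g₁ kh kv ≠ 0 ∧ g₂ kh kv ≠ 0 :=
  mul_ne_zero_iff.mp h

/-- **`hone` of the socket**: where the envelope factor vanishes the tracked symbol `1 − g·g_env` equals `1`. [folklore] -/
theorem one_sub_prod_eq_one_of_right_eq_zero {g₁ g₂ : ℤ → ℤ → ℝ} {kh kv : ℤ} (h : g₂ kh kv = 0) :
    1 - g₁ kh kv * g₂ kh kv = 1 := by rw [h, mul_zero, sub_zero]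

/-- **Compatibility of a product from the two implications**: if `0 ≤ g₁, g₂`, `0 ≤ g₁′, g₂′ ≤ 1` and `g₁ > 0 ⇒ g₁′ = 1`,
`g₂ > 0 ⇒ g₂′ = 1` (values at the relevant pair of lattice points), then `(1 − g₁′g₂′)² ≤ (1 − g₁g₂)²`. [folklore] -/
theorem compat_mul {x₁ x₂ y₁ y₂ : ℝ} (hx₁ : 0 ≤ x₁) (hx₂ : 0 ≤ x₂) (hy₁ : 0 ≤ y₁) (hy₁1 : y₁ ≤ 1) (hy₂ : 0 ≤ y₂)
    (hy₂1 : y₂ ≤ 1) (h₁ : 0 < x₁ → y₁ = 1) (h₂ : 0 < x₂ → y₂ = 1) : (1 - y₁ * y₂) ^ 2 ≤ (1 - x₁ * x₂) ^ 2 := by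
  refine sq_one_sub_le_of_eq_one_on_supp (mul_nonneg hx₁ hx₂) (mul_nonneg hy₁ hy₂) (mul_le_one₀ hy₁1 hy₂ hy₂1) fun hpos => ?_
  have h1 : 0 < x₁ := lt_of_le_of_ne hx₁ fun h => by rw [← h, zero_mul] at hpos; exact lt_irrefl _ hpos
  have h2 : 0 < x₂ := lt_of_le_of_ne hx₂ fun h => by rw [← h, mul_zero] at hpos; exact lt_irrefl _ hpos
  rw [h₁ h1, h₂ h2, mul_one]

/-! ## The implication forms of the cone and envelope steps -/

/-- **H half-step, implication form**: with the data of `compat_H`, `g^S(k_h,k_v) ≠ 0 ⇒ g^M(k_h, k_v − b) = 1`.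
[cite: ElgindiLissMattingly2025, §1.2.2 (cones and cocycle)] -/
theorem eq_one_of_ne_zero_H {γ a' a₂ L : ℝ} (hγ : 0 ≤ γ) (hL : 0 < L) (ha₂ : a' + γ / (2 * L) ≤ a₂)
    {gS gM : ℤ → ℤ → ℝ}
    (hS_supp : ∀ kh kv : ℤ, gS kh kv ≠ 0 → L < |(kh : ℝ)| ∧ γ * |(kv : ℝ)| < a' * |(kh : ℝ)|)
    (hM_one : ∀ (kh kv : ℤ) (σ : ℝ), σ = 1 ∨ σ = -1 → L < |(kh : ℝ)| →
      γ * |(kv : ℝ) + σ * γ * kh| ≤ a₂ * |(kh : ℝ)| → gM kh kv = 1)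
    (kh kv b : ℤ) {σ : ℝ} (hσ : σ = 1 ∨ σ = -1) (hb : |(b : ℝ) - σ * γ * kh| ≤ 1 / 2) (hne : gS kh kv ≠ 0) :
    gM kh (kv - b) = 1 := by
  obtain ⟨hkh, hkv⟩ := hS_supp kh kv hne
  have himg := coneH_image (σ := σ) hγ hL hkh hkv hb
  exact hM_one kh (kv - b) σ hσ hkh (himg.le.trans (mul_le_mul_of_nonneg_right ha₂ (abs_nonneg _)))

/-- **V half-step, implication form**: with the data of `compat_V`, `g^M(k_h,k_v) ≠ 0 ⇒ g^{S'}(k_h − b', k_v) = 1`.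
[cite: ElgindiLissMattingly2025, §3.1 Lemma 3.1 (cone invariance and expansion)] -/
theorem eq_one_of_ne_zero_V {γ a a' L L' : ℝ} (hγ : 1 ≤ γ) (ha : 0 ≤ a) (hL : 0 < L) (ha' : a' ≤ γ ^ 2 - 1)
    (hca : γ ^ 2 + a' + a / (2 * L) ≤ a * (γ ^ 2 - 1 - a')) (hL' : L' ≤ (γ ^ 2 - 1 - a') * L - 1 / 2)
    {gM gS' : ℤ → ℤ → ℝ}
    (hM_supp : ∀ kh kv : ℤ, gM kh kv ≠ 0 → L < |(kh : ℝ)| ∧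
      ∃ σ : ℝ, (σ = 1 ∨ σ = -1) ∧ γ * |(kv : ℝ) + σ * γ * kh| < a' * |(kh : ℝ)|)
    (hS_one : ∀ kh kv : ℤ, L' ≤ |(kh : ℝ)| → γ * |(kv : ℝ)| ≤ a * |(kh : ℝ)| → gS' kh kv = 1)
    (kh kv b' : ℤ) {σ' : ℝ} (hσ' : σ' = 1 ∨ σ' = -1) (hb' : |(b' : ℝ) - σ' * γ * kv| ≤ 1 / 2) (hne : gM kh kv ≠ 0) :
    gS' (kh - b') kv = 1 := by
  obtain ⟨hkh, σ, hσ, hcone⟩ := hM_supp kh kv hne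
  have hrad := coneV_radial hγ hσ hσ' hcone hb'
  have hcn := coneV_cone hγ ha hL hσ hσ' hca hkh hcone hb'
  refine hS_one (kh - b') kv (hL'.trans ?_) hcn
  have : (γ ^ 2 - 1 - a') * L ≤ (γ ^ 2 - 1 - a') * |(kh : ℝ)| := mul_le_mul_of_nonneg_left hkh.le (by linarith)
  linarith

/-- **Envelope step, implication form**: with the data of `compat_env`, `g(k_a,k_c) ≠ 0 ⇒ g'(k_a, k_c − b) = 1`.
[cite: ElgindiLissMattingly2025, §1.2.2 (the cocycle A(r,s))] -/
theorem eq_one_of_ne_zero_env {γ R R' : ℝ} (hγ : 0 ≤ γ) (hR' : (1 + γ) * R + 1 / 2 ≤ R') {g g' : ℤ → ℤ → ℝ}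
    (hg_supp : ∀ ka kc : ℤ, g ka kc ≠ 0 → |(ka : ℝ)| < R ∧ |(kc : ℝ)| < R)
    (hg'_one : ∀ ka kc : ℤ, |(ka : ℝ)| < R' → |(kc : ℝ)| < R' → g' ka kc = 1)
    (ka kc b : ℤ) {σ : ℝ} (hσ : σ = 1 ∨ σ = -1) (hb : |(b : ℝ) - σ * γ * ka| ≤ 1 / 2) (hne : g ka kc ≠ 0) :
    g' ka (kc - b) = 1 := by
  obtain ⟨hka, hkc⟩ := hg_supp ka kc hne
  obtain ⟨h1, h2⟩ := ball_image hγ hσ hR' hka hkc hb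
  exact hg'_one ka (kc - b) h1 h2

/-- **Envelope step along the V half-slot** (kept coordinate `k_v`, shifted `k_h`), implication form for an envelope written
with the arguments in the order `(k_h, k_v)`: `g(k_h,k_v) ≠ 0 ⇒ g'(k_h − b', k_v) = 1`.
[cite: ElgindiLissMattingly2025, §1.2.2 (the cocycle A(r,s))] -/
theorem eq_one_of_ne_zero_env_V {γ R R' : ℝ} (hγ : 0 ≤ γ) (hR' : (1 + γ) * R + 1 / 2 ≤ R') {g g' : ℤ → ℤ → ℝ}
    (hg_supp : ∀ kh kv : ℤ, g kh kv ≠ 0 → |(kh : ℝ)| < R ∧ |(kv : ℝ)| < R)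
    (hg'_one : ∀ kh kv : ℤ, |(kh : ℝ)| < R' → |(kv : ℝ)| < R' → g' kh kv = 1)
    (kh kv b' : ℤ) {σ' : ℝ} (hσ' : σ' = 1 ∨ σ' = -1) (hb' : |(b' : ℝ) - σ' * γ * kv| ≤ 1 / 2) (hne : g kh kv ≠ 0) :
    g' (kh - b') kv = 1 := by
  obtain ⟨hkh, hkv⟩ := hg_supp kh kv hne
  obtain ⟨h1, h2⟩ := ball_image hγ hσ' hR' hkv hkh hb'
  exact hg'_one (kh - b') kv h2 h1

/-! ## Fibre profiles: `1 − μ`, `1 − f·g`, `(1 − f·g)²` at scale `b` -/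

/-- **Complement at scale `b`**: if `|μ⁽ⁱ⁾| ≤ Cᵢ/bⁱ` then `|(1 − μ)⁽ⁱ⁾| ≤ (Cᵢ + 1)/bⁱ` (`b > 0`). [folklore] -/
theorem abs_iteratedDeriv_one_sub_le_of_scale {μ : ℝ → ℝ} {b : ℝ} (hb : 0 < b) {C : ℕ → ℝ}
    (hC : ∀ i x, |iteratedDeriv i μ x| ≤ C i / b ^ i) (i : ℕ) (x : ℝ) :
    |iteratedDeriv i (fun t => 1 - μ t) x| ≤ (C i + 1) / b ^ i := by
  have hC0 : 0 ≤ C i := by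
    have h := (abs_nonneg _).trans (hC i 0)
    rwa [le_div_iff₀ (pow_pos hb i), zero_mul] at h
  rcases Nat.eq_zero_or_pos i with rfl | hi
  · rw [iteratedDeriv_zero, pow_zero, div_one]
    have h := hC 0 x
    rw [iteratedDeriv_zero, pow_zero, div_one] at h
    calc |1 - μ x| ≤ |(1 : ℝ)| + |μ x| := abs_sub _ _
      _ ≤ C 0 + 1 := by rw [abs_one]; linarith
  · rw [iteratedDeriv_const_sub hi, iteratedDeriv_neg, abs_neg]
    exact (hC i x).trans (div_le_div_of_nonneg_right (by linarith) (pow_pos hb i).le)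

/-- **`1 − f·g` at scale `b`**: if `f, g` are smooth with `|f⁽ⁱ⁾| ≤ Cfᵢ/bⁱ`, `|g⁽ⁱ⁾| ≤ Cgᵢ/bⁱ` for all `i`, then for every `n`:
`|(1 − f·g)⁽ⁿ⁾| ≤ (1 + Σᵢ C(n,i) Cfᵢ Cg_{n−i})/bⁿ`. [cite: Grafakos2014, Prop. 3.1.2 (5)] -/
theorem abs_iteratedDeriv_one_sub_mul_le_of_scale {f g : ℝ → ℝ} (hf : ContDiff ℝ ∞ f) (hg : ContDiff ℝ ∞ g) {b : ℝ}
    (hb : 0 < b) {Cf Cg : ℕ → ℝ} (hCf : ∀ i x, |iteratedDeriv i f x| ≤ Cf i / b ^ i)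
    (hCg : ∀ i x, |iteratedDeriv i g x| ≤ Cg i / b ^ i) (n : ℕ) (x : ℝ) :
    |iteratedDeriv n (fun t => 1 - f t * g t) x| ≤
      (1 + ∑ i ∈ Finset.range (n + 1), (n.choose i : ℝ) * Cf i * Cg (n - i)) / b ^ n := by
  have hprod : ∀ m y, |iteratedDeriv m (fun t => f t * g t) y| ≤
      (∑ i ∈ Finset.range (m + 1), (m.choose i : ℝ) * Cf i * Cg (m - i)) / b ^ m := fun m y =>
    K1Cutoff.abs_iteratedDeriv_mul_le_of_scale hf hg hb (fun i _ x => hCf i x) (fun i _ x => hCg i x) y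
  have hK0 : 0 ≤ ∑ i ∈ Finset.range (n + 1), (n.choose i : ℝ) * Cf i * Cg (n - i) := by
    have h := (abs_nonneg _).trans (hprod n x)
    rwa [le_div_iff₀ (pow_pos hb n), zero_mul] at h
  rcases Nat.eq_zero_or_pos n with hn | hn
  · subst hn
    rw [iteratedDeriv_zero, pow_zero, div_one]
    have h := hprod 0 x
    rw [iteratedDeriv_zero, pow_zero, div_one] at h
    calc |1 - f x * g x| ≤ |(1 : ℝ)| + |f x * g x| := abs_sub _ _
      _ ≤ 1 + _ := by rw [abs_one]; exact add_le_add le_rfl h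
  · rw [iteratedDeriv_const_sub hn, iteratedDeriv_neg, abs_neg]
    exact (hprod n x).trans (div_le_div_of_nonneg_right (by linarith) (pow_pos hb n).le)

/-- `t ↦ 1 − f t · g t` is smooth. [folklore] -/
theorem contDiff_one_sub_mul {f g : ℝ → ℝ} (hf : ContDiff ℝ ∞ f) (hg : ContDiff ℝ ∞ g) :
    ContDiff ℝ ∞ (fun t => 1 - f t * g t) := contDiff_const.sub (hf.mul hg)

/-- **`(1 − f·g)²` at scale `b`**: with `K_m = 1 + Σᵢ C(m,i) Cfᵢ Cg_{m−i}` the bound of the previous lemma,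
`|((1 − f·g)²)⁽ⁿ⁾| ≤ (Σᵢ C(n,i) Kᵢ K_{n−i})/bⁿ`. [cite: Grafakos2014, Prop. 3.1.2 (5)] -/
theorem abs_iteratedDeriv_one_sub_mul_sq_le_of_scale {f g : ℝ → ℝ} (hf : ContDiff ℝ ∞ f) (hg : ContDiff ℝ ∞ g) {b : ℝ}
    (hb : 0 < b) {Cf Cg : ℕ → ℝ} (hCf : ∀ i x, |iteratedDeriv i f x| ≤ Cf i / b ^ i)
    (hCg : ∀ i x, |iteratedDeriv i g x| ≤ Cg i / b ^ i) (n : ℕ) (x : ℝ) :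
    |iteratedDeriv n (fun t => (1 - f t * g t) ^ 2) x| ≤
      (∑ i ∈ Finset.range (n + 1), (n.choose i : ℝ) *
        (1 + ∑ l ∈ Finset.range (i + 1), (i.choose l : ℝ) * Cf l * Cg (i - l)) *
        (1 + ∑ l ∈ Finset.range (n - i + 1), ((n - i).choose l : ℝ) * Cf l * Cg (n - i - l))) / b ^ n :=
  K1Cutoff.abs_iteratedDeriv_sq_le_of_scale (contDiff_one_sub_mul hf hg) hb
    (fun i _ y => abs_iteratedDeriv_one_sub_mul_le_of_scale hf hg hb hCf hCg i y) x

end Summit.AnomalousDissipation.AnomalousDissipation.Theorems.SawtoothPulseCascade.K1Symbol
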